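import Summits.BirchSwinnertonDyer.BirchSwinnertonDyer.Theorems.ClassRecordThreeHsiehDescentUnramifiedPeriodItems
import HarnessLib

/-!
# Routes `ClassRecordThree` ∕ `KolyvaginRoadThree`, crux `HsiehDescentAtThree` (item stmt-BirchSwinnertonDyer-19108):
# TIGHTNESS WITHOUT TATE–SEN — modulo Hsieh 2014 Thm. 5.6 with `Ω_p ∈ 𝒲^×` (a published input the route already cites, in
# sharpened typing), the crux IS inertial value reciprocity on the κ-range

Cell `bsd-stepL`, seat `bsd-stepL-desc3-p1` (prover g3), `--supports stmt-BirchSwinnertonDyer-19108`. Sequel of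
`ClassRecordThreeHsiehDescentUnramifiedPeriodItems`. g2's iff (`classRecordThree_hsiehDescentAtThree_iff_inertialReciprocity`)
holds modulo the printed Tate–Sen theorem; here the same iff modulo the Literature fact
`hsieh2014_exists_anticyclotomicPAdicLFunction_unrPeriod` instead (p451301): `→` is x11b3-p3's S30-e
(`Three.inertialExactness_of_hsiehDescentAt₃`, unconditional), `←` is `hsiehDescentAt₃_of_inertialReciprocity_of_unrPeriodWitness`
(p451579) fed by `unrPeriodWitness_of_hsieh2014_unrPeriod` (p451946). HONEST FRAMING: an iff between OPEN statements modulo a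
named fact; nothing discharged; item 19108 OPEN; no census word (T7).
References: [Hsieh2014] Thm. 5.6, p. 23 l. 64; [CastellaHsieh2018] §2.5; tree S30-e `X11b/Three/LocalExactnessOfDescent.lean`.
-/

noncomputable section

set_option linter.dupNamespace false

open scoped NumberField Topology
open Filter NumberField IsDedekindDomain Field PowerSeries WeierstrassCurve
open Literature.NumberTheory.GaloisRepresentations Literature.NumberTheory.EllipticCurves
open Literature.NumberTheory.EllipticCurves.ModularForms
open Literature.NumberTheory.EllipticCurves.Rank1Residual (Surj Ram)
open Summit.BirchSwinnertonDyer.Rank1Residual Summit.BirchSwinnertonDyer.Rank1Residual.X11b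
open Summit.BirchSwinnertonDyer.Rank1Residual.X11b.Three

namespace Summit.BirchSwinnertonDyer.BirchSwinnertonDyer.Theorems

/-- **Per-curve IFF without Tate–Sen**: given the `R₀`-period Hsieh witnesses for `W` (⟸ the Literature fact
`hsieh2014_exists_anticyclotomicPAdicLFunction_unrPeriod` by `unrPeriodWitness_of_hsieh2014_unrPeriod`), the node
`Three.HsiehDescentAt₃ W` is EQUIVALENT to inertial value reciprocity on the κ-range (S30-e's conclusion).
[cite: Hsieh2014, Thm. 5.6 (arXiv:1112.1580 p. 23)] [cite: CastellaHsieh2018, §2.5 (arXiv:1505.08165 p. 7)] -/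
theorem hsiehDescentAt₃_iff_inertialReciprocity_of_hsieh2014_unrPeriod
    (hH : hsieh2014_exists_anticyclotomicPAdicLFunction_unrPeriod)
    (W : WeierstrassCurve ℚ) [W.IsElliptic] [W.IsGloballyMinimal] :
    HsiehDescentAt₃ W ↔
  ∀ (ι' : PadicAlgCl 3 ≃+* ℂ) (K : Type) [Field K] [NumberField K]
        (𝔭 : HeightOneSpectrum (𝓞 K)) (κ : ZpExtension K 3) (γ : Field.absoluteGaloisGroup K)
        {N : ℕ} [NeZero N] {f : CuspForm (CongruenceSubgroup.Gamma0 N) 2}, IsNewformOf W f →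
        ClassX11b W 3 → Surj W 3 → W.conductorNorm ℤ = N → IsImaginaryQuadratic K →
        Odd (NumberField.discr K) → SatisfiesHeegnerHypothesis N K →
        ((Ideal.span {(3 : ℤ)}).primesOver (𝓞 K)).ncard = 2 → ((3 : ℕ) : 𝓞 K) ∈ 𝔭.asIdeal →
        𝔭.asIdeal.ramificationIdx (𝓞 ℚ) = 1 → 𝔭.asIdeal.inertiaDeg (𝓞 ℚ) = 1 →
        (∀ (w : InfinitePlace K) (k : 𝓞 K), k ∈ 𝔭.asIdeal ↔ ‖ι'.symm (w.embedding (k : K))‖ < 1) →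
        (∀ ℓ : ℕ, ℓ.Prime → ℓ ∣ N → ∃ v : HeightOneSpectrum (𝓞 K), Ideal.absNorm v.asIdeal = ℓ) →
        κ.IsAnticyclotomic → κ.IsTopGenerator γ →
        ∀ (A : ℝ) (ΩK C : ℂ) (Ωp : ℂ_[3]) (Q : PowerSeries (PadicComplexInt 3)),
          0 < A → ΩK ≠ 0 → ‖((ι'.symm C : PadicAlgCl 3) : ℂ_[3])‖ = 1 → ‖Ωp‖ = 1 →
          IsHsiehLFunction ι' 𝔭 κ γ f A ΩK C Ωp Q →
          ∃ Ω : ℂ, Ω ≠ 0 ∧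
            ∀ (τ : PadicAlgCl 3 ≃ₐ[ℚ_[3]] PadicAlgCl 3) (σ : ℂ ≃ₐ[ℚ] ℂ),
              (∀ ζ : PadicAlgCl 3, (∃ m : ℕ, 0 < m ∧ ¬ 3 ∣ m ∧ ζ ^ m = 1) → τ ζ = ζ) →
              (∀ z : PadicAlgCl 3, σ (ι' z) = ι' (τ z)) →
              ∀ (χ : HeckeCharacter K) (n : ℕ), 0 < n →
                (∀ v : HeightOneSpectrum (𝓞 K), χ.IsUnramifiedAt v) →
                ∀ hχ : χ.HasInfinityType (fun _ ↦ (n : ℤ)) (fun _ ↦ -(n : ℤ)),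
                  ∀ r : FramedGaloisRep K (PadicAlgCl 3) 1, IsPAdicAvatarOf ι' χ r → FactorsThroughZp κ r →
                    σ (bdpInterpolationValue 3 f 𝔭 χ n Ω) =
                      bdpInterpolationValue 3 f 𝔭 (hχ.autConj σ) n Ω :=
  ⟨inertialExactness_of_hsiehDescentAt₃ W,
    fun hVR ↦ hsiehDescentAt₃_of_inertialReciprocity_of_unrPeriodWitness W hVR
      (unrPeriodWitness_of_hsieh2014_unrPeriod hH W)⟩

/-- **Crux-level IFF without Tate–Sen: modulo the Literature fact `hsieh2014_exists_anticyclotomicPAdicLFunction_unrPeriod`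
(Hsieh 2014 Thm. 5.6, `Ω_p ∈ 𝒲^×`), item 19108 `HsiehDescentAtThree` is EQUIVALENT to the same two-locus statement with the
node replaced by inertial value reciprocity** — the archimedean input (BDP13 reciprocity, in inertial form) is necessary and
sufficient, and NO p-adic Hodge theory input remains. [cite: Hsieh2014, Thm. 5.6 (arXiv:1112.1580 p. 23)] -/
theorem classRecordThree_hsiehDescentAtThree_iff_inertialReciprocity_of_hsieh2014_unrPeriod
    (hH : hsieh2014_exists_anticyclotomicPAdicLFunction_unrPeriod) :
    Summit.BirchSwinnertonDyer.BirchSwinnertonDyer.Theses.ClassRecordThree.HsiehDescentAtThree ↔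
    ∀ (W : WeierstrassCurve ℚ) [W.IsElliptic] [W.IsGloballyMinimal], ClassX11b W 3 →
      (Ram W 3 → W.HasSplitMultiplicativeReductionAtPrime 3 →
  ∀ (ι' : PadicAlgCl 3 ≃+* ℂ) (K : Type) [Field K] [NumberField K]
          (𝔭 : HeightOneSpectrum (𝓞 K)) (κ : ZpExtension K 3) (γ : Field.absoluteGaloisGroup K)
          {N : ℕ} [NeZero N] {f : CuspForm (CongruenceSubgroup.Gamma0 N) 2}, IsNewformOf W f →
          ClassX11b W 3 → Surj W 3 → W.conductorNorm ℤ = N → IsImaginaryQuadratic K →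
          Odd (NumberField.discr K) → SatisfiesHeegnerHypothesis N K →
          ((Ideal.span {(3 : ℤ)}).primesOver (𝓞 K)).ncard = 2 → ((3 : ℕ) : 𝓞 K) ∈ 𝔭.asIdeal →
          𝔭.asIdeal.ramificationIdx (𝓞 ℚ) = 1 → 𝔭.asIdeal.inertiaDeg (𝓞 ℚ) = 1 →
          (∀ (w : InfinitePlace K) (k : 𝓞 K), k ∈ 𝔭.asIdeal ↔ ‖ι'.symm (w.embedding (k : K))‖ < 1) →
          (∀ ℓ : ℕ, ℓ.Prime → ℓ ∣ N → ∃ v : HeightOneSpectrum (𝓞 K), Ideal.absNorm v.asIdeal = ℓ) →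
          κ.IsAnticyclotomic → κ.IsTopGenerator γ →
          ∀ (A : ℝ) (ΩK C : ℂ) (Ωp : ℂ_[3]) (Q : PowerSeries (PadicComplexInt 3)),
            0 < A → ΩK ≠ 0 → ‖((ι'.symm C : PadicAlgCl 3) : ℂ_[3])‖ = 1 → ‖Ωp‖ = 1 →
            IsHsiehLFunction ι' 𝔭 κ γ f A ΩK C Ωp Q →
            ∃ Ω : ℂ, Ω ≠ 0 ∧
              ∀ (τ : PadicAlgCl 3 ≃ₐ[ℚ_[3]] PadicAlgCl 3) (σ : ℂ ≃ₐ[ℚ] ℂ),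
                (∀ ζ : PadicAlgCl 3, (∃ m : ℕ, 0 < m ∧ ¬ 3 ∣ m ∧ ζ ^ m = 1) → τ ζ = ζ) →
                (∀ z : PadicAlgCl 3, σ (ι' z) = ι' (τ z)) →
                ∀ (χ : HeckeCharacter K) (n : ℕ), 0 < n →
                  (∀ v : HeightOneSpectrum (𝓞 K), χ.IsUnramifiedAt v) →
                  ∀ hχ : χ.HasInfinityType (fun _ ↦ (n : ℤ)) (fun _ ↦ -(n : ℤ)),
                    ∀ r : FramedGaloisRep K (PadicAlgCl 3) 1, IsPAdicAvatarOf ι' χ r → FactorsThroughZp κ r →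
                      σ (bdpInterpolationValue 3 f 𝔭 χ n Ω) =
                        bdpInterpolationValue 3 f 𝔭 (hχ.autConj σ) n Ω) ∧
      (¬ Ram W 3 → Surj W 3 →
  ∀ (ι' : PadicAlgCl 3 ≃+* ℂ) (K : Type) [Field K] [NumberField K]
          (𝔭 : HeightOneSpectrum (𝓞 K)) (κ : ZpExtension K 3) (γ : Field.absoluteGaloisGroup K)
          {N : ℕ} [NeZero N] {f : CuspForm (CongruenceSubgroup.Gamma0 N) 2}, IsNewformOf W f →
          ClassX11b W 3 → Surj W 3 → W.conductorNorm ℤ = N → IsImaginaryQuadratic K →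
          Odd (NumberField.discr K) → SatisfiesHeegnerHypothesis N K →
          ((Ideal.span {(3 : ℤ)}).primesOver (𝓞 K)).ncard = 2 → ((3 : ℕ) : 𝓞 K) ∈ 𝔭.asIdeal →
          𝔭.asIdeal.ramificationIdx (𝓞 ℚ) = 1 → 𝔭.asIdeal.inertiaDeg (𝓞 ℚ) = 1 →
          (∀ (w : InfinitePlace K) (k : 𝓞 K), k ∈ 𝔭.asIdeal ↔ ‖ι'.symm (w.embedding (k : K))‖ < 1) →
          (∀ ℓ : ℕ, ℓ.Prime → ℓ ∣ N → ∃ v : HeightOneSpectrum (𝓞 K), Ideal.absNorm v.asIdeal = ℓ) →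
          κ.IsAnticyclotomic → κ.IsTopGenerator γ →
          ∀ (A : ℝ) (ΩK C : ℂ) (Ωp : ℂ_[3]) (Q : PowerSeries (PadicComplexInt 3)),
            0 < A → ΩK ≠ 0 → ‖((ι'.symm C : PadicAlgCl 3) : ℂ_[3])‖ = 1 → ‖Ωp‖ = 1 →
            IsHsiehLFunction ι' 𝔭 κ γ f A ΩK C Ωp Q →
            ∃ Ω : ℂ, Ω ≠ 0 ∧
              ∀ (τ : PadicAlgCl 3 ≃ₐ[ℚ_[3]] PadicAlgCl 3) (σ : ℂ ≃ₐ[ℚ] ℂ),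
                (∀ ζ : PadicAlgCl 3, (∃ m : ℕ, 0 < m ∧ ¬ 3 ∣ m ∧ ζ ^ m = 1) → τ ζ = ζ) →
                (∀ z : PadicAlgCl 3, σ (ι' z) = ι' (τ z)) →
                ∀ (χ : HeckeCharacter K) (n : ℕ), 0 < n →
                  (∀ v : HeightOneSpectrum (𝓞 K), χ.IsUnramifiedAt v) →
                  ∀ hχ : χ.HasInfinityType (fun _ ↦ (n : ℤ)) (fun _ ↦ -(n : ℤ)),
                    ∀ r : FramedGaloisRep K (PadicAlgCl 3) 1, IsPAdicAvatarOf ι' χ r → FactorsThroughZp κ r →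
                      σ (bdpInterpolationValue 3 f 𝔭 χ n Ω) =
                        bdpInterpolationValue 3 f 𝔭 (hχ.autConj σ) n Ω) := by
  constructor
  · intro h W _ _ hX
    obtain ⟨h₁, h₂⟩ := h W hX
    exact ⟨fun hr hs ↦ (hsiehDescentAt₃_iff_inertialReciprocity_of_hsieh2014_unrPeriod hH W).1 (h₁ hr hs),
      fun hr hs ↦ (hsiehDescentAt₃_iff_inertialReciprocity_of_hsieh2014_unrPeriod hH W).1 (h₂ hr hs)⟩
  · intro h W _ _ hX
    obtain ⟨h₁, h₂⟩ := h W hX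
    exact ⟨fun hr hs ↦ (hsiehDescentAt₃_iff_inertialReciprocity_of_hsieh2014_unrPeriod hH W).2 (h₁ hr hs),
      fun hr hs ↦ (hsiehDescentAt₃_iff_inertialReciprocity_of_hsieh2014_unrPeriod hH W).2 (h₂ hr hs)⟩

end Summit.BirchSwinnertonDyer.BirchSwinnertonDyer.Theorems

end
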